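import Literature.MeasureTheory.Group.SL2IwasawaHaar
import Mathlib.MeasureTheory.Integral.IntegralEqImproper
import Mathlib.Analysis.SpecialFunctions.ImproperIntegrals
import HarnessLib

/-!
# Integrals of coordinate functions for the Haar measure of `SL₂^±(ℝ)`; the cusp strip and the
# body rectangle of Gauss's fundamental domain

Topic `Literature/MeasureTheory/Group`; continues `SL2IwasawaHaar.lean` (`haarSL2pm`,
`coordSet A Θ`, `haarSL2pm_coordSet : μ(coordSet A Θ) = vol_ℍ(A)·|Θ|`, `volume_coe_preimage`).
Everything here is PROVED (no named facts).

For the averaging method of Bhargava–Shankar (§2.3 of `arXiv:1006.1002v2`: "cutting off the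
cusp", the integrals `∫ t^k · t⁻² dn d^×t dk` over the Siegel set) one needs to integrate functions
of the Iwasawa coordinates against the Haar measure. We prove:

* `setLIntegral_upperHalfPlane`, `setLIntegral_coe_preimage`: `∫_S F = ∫ F(w) dx dy / y²` on `ℍ`
  (function version of Mathlib's `UpperHalfPlane.volume_eq_lintegral`);
* **`setLIntegral_haarSL2pm_coordSet`**:
  `∫_{coordSet A Θ} F(x(g) + i y(g)) dμ(g) = (∫_A F(w) dx dy / y²) · |Θ|`;
* the strip `stripAbove Y₀ = {|x| ≤ ½, y > Y₀}` has hyperbolic area `1/Y₀`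
  (`lintegral_stripAbove`, via `∫_{Y₀}^∞ y⁻² = 1/Y₀`), and on the rectangle
  `rectBetween a Y₀ = {|x| ≤ ½, a ≤ y ≤ Y₀}` one has `∫ y² · y⁻² dx dy = Y₀ − a`
  (`lintegral_rectBetween`).

## References

* M. Bhargava, A. Shankar, Ann. of Math. (2) 181 (2015) 191–242, §2.3 (arXiv:1006.1002v2
  numbering). [cite: BhargavaShankarAnnals2015, §2.3 (cutting off the cusp; arXiv:1006.1002v2 numbering)]
-/

noncomputable section

open Real MeasureTheory Matrix Complex Set Filter Topology
open scoped MatrixGroups UpperHalfPlane ENNReal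

namespace Literature.MeasureTheory.Group

attribute [local instance] fact_two_pi_pos

/-! ## Set integrals on the upper half-plane in coordinates -/

/-- **Integration on `ℍ` in coordinates**: for a measurable `F : ℂ → ℝ≥0∞` and a measurable
`S ⊆ ℍ`, `∫_S F = ∫_{S ⊂ ℂ} F(w) dx dy / y²`. [folklore] -/
theorem setLIntegral_upperHalfPlane (F : ℂ → ℝ≥0∞) (hF : Measurable F) {S : Set ℍ} (hS : MeasurableSet S) :
    ∫⁻ z in S, F z ∂volume = ∫⁻ w in ((↑) : ℍ → ℂ) '' S, F w * ENNReal.ofReal (1 / w.im ^ 2) ∂volume := by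
  have hmp : MeasurePreserving UpperHalfPlane.coe (volume.comap UpperHalfPlane.coe)
      (volume.restrict (Set.range UpperHalfPlane.coe)) :=
    ⟨UpperHalfPlane.measurable_coe, by rw [UpperHalfPlane.measurableEmbedding_coe.map_comap]⟩
  have hρ : Measurable fun z : ℍ => (((1 / NNReal.mk z.im z.im_pos.le : NNReal) ^ 2 : NNReal) : ℝ≥0∞) := by
    refine Measurable.coe_nnreal_ennreal (Measurable.pow_const (Measurable.div measurable_const ?_) _)
    exact (UpperHalfPlane.continuous_im.subtype_mk _).measurable
  have h1 : ∫⁻ z in S, F z ∂((volume.comap UpperHalfPlane.coe).withDensity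
        fun z : ℍ => (((1 / NNReal.mk z.im z.im_pos.le : NNReal) ^ 2 : NNReal) : ℝ≥0∞)) =
      ∫⁻ z in S, ((fun z : ℍ => (((1 / NNReal.mk z.im z.im_pos.le : NNReal) ^ 2 : NNReal) : ℝ≥0∞)) *
        (F ∘ UpperHalfPlane.coe)) z ∂(volume.comap UpperHalfPlane.coe) :=
    setLIntegral_withDensity_eq_setLIntegral_mul _ hρ (hF.comp UpperHalfPlane.measurable_coe) hS
  have e : ∀ z : ℍ, ((fun z : ℍ => (((1 / NNReal.mk z.im z.im_pos.le : NNReal) ^ 2 : NNReal) : ℝ≥0∞)) *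
      (F ∘ UpperHalfPlane.coe)) z = (fun w : ℂ => F w * ENNReal.ofReal (1 / w.im ^ 2)) (z : ℂ) := by
    intro z
    have hmk : NNReal.mk z.im z.im_pos.le = ‖z.im‖₊ := NNReal.coe_injective (by simp [abs_of_pos z.im_pos])
    simp only [Pi.mul_apply, Function.comp_apply, UpperHalfPlane.coe_im]
    rw [mul_comm, ← ennreal_one_div_nnnorm_sq z.im_pos, hmk]
  have h2 := hmp.setLIntegral_comp_emb UpperHalfPlane.measurableEmbedding_coe
    (fun w : ℂ => F w * ENNReal.ofReal (1 / w.im ^ 2)) S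
  rw [UpperHalfPlane.volume_def, h1, lintegral_congr e]
  refine h2.trans ?_
  rw [Measure.restrict_restrict' UpperHalfPlane.measurableEmbedding_coe.measurableSet_range,
    Set.inter_eq_self_of_subset_left (Set.image_subset_range _ _)]

/-- The same for a coordinate preimage `S = (↑)⁻¹' A`, `A ⊆ {Im > 0}`. [folklore] -/
theorem setLIntegral_coe_preimage {A : Set ℂ} (hA : MeasurableSet A) (hA' : A ⊆ {w | 0 < w.im}) (F : ℂ → ℝ≥0∞)
    (hF : Measurable F) :
    ∫⁻ z in ((↑) : ℍ → ℂ) ⁻¹' A, F z ∂volume = ∫⁻ w in A, F w * ENNReal.ofReal (1 / w.im ^ 2) ∂volume := by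
  rw [setLIntegral_upperHalfPlane F hF (UpperHalfPlane.measurable_coe hA)]
  have e : ((↑) : ℍ → ℂ) '' (((↑) : ℍ → ℂ) ⁻¹' A) = A := by
    rw [Set.image_preimage_eq_inter_range]
    exact Set.inter_eq_left.2 fun w hw => ⟨⟨w, hA' hw⟩, rfl⟩
  rw [e]

/-! ## Set integrals of coordinate functions for the Haar measure -/

section Measure

variable [MeasurableSpace (Matrix (Fin 2) (Fin 2) ℝ)] [BorelSpace (Matrix (Fin 2) (Fin 2) ℝ)]

/-- On subsets of `SL₂(ℝ)`, set integrals for the Haar measure of `SL₂^±(ℝ)` are set integrals for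
the Iwasawa measure. [folklore] -/
theorem setLIntegral_haarSL2pm_of_subset {E : Set (Matrix (Fin 2) (Fin 2) ℝ)} (hE : MeasurableSet E)
    (hE1 : E ⊆ {g | g.det = 1}) (f : Matrix (Fin 2) (Fin 2) ℝ → ℝ≥0∞) :
    ∫⁻ g in E, f g ∂haarSL2pm = ∫⁻ g in E, f g ∂iwasawaMeasure := by
  have h0 : (Measure.map (fun g => sigmaMat * g) iwasawaMeasure) E = 0 := by
    rw [Measure.map_apply (measurable_mul_left _) hE, iwasawaMeasure_apply ((measurable_mul_left _) hE)]
    have : iwasawa ⁻¹' ((fun g => sigmaMat * g) ⁻¹' E) = ∅ := by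
      ext p
      simp only [Set.mem_preimage, Set.mem_empty_iff_false, iff_false]
      intro hp
      have := hE1 hp
      simp only [Set.mem_setOf_eq, Matrix.det_mul, det_sigmaMat, det_iwasawa] at this
      norm_num at this
    rw [this, measure_empty]
  rw [haarSL2pm, Measure.restrict_add, lintegral_add_measure, Measure.restrict_eq_zero.2 h0, lintegral_zero_measure,
    add_zero]

/-- **Integration of a function of `g · i` over a coordinate set**:
`∫_{coordSet A Θ} F(x(g) + i y(g)) dμ(g) = (∫_A F(w) dx dy / y²) · |Θ|`. [folklore] -/
theorem setLIntegral_haarSL2pm_coordSet {A : Set ℂ} (hA : MeasurableSet A) (hA' : A ⊆ {w | 0 < w.im})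
    {Θ : Set (AddCircle (2 * π))} (hΘ : MeasurableSet Θ) (F : ℂ → ℝ≥0∞) (hF : Measurable F) :
    ∫⁻ g in coordSet A Θ, F ⟨xOf g, yOf g⟩ ∂haarSL2pm = (∫⁻ w in A, F w * ENNReal.ofReal (1 / w.im ^ 2) ∂volume) * volume Θ := by
  have hm := measurableSet_coordSet hA hΘ
  have hFc : Measurable fun g : Matrix (Fin 2) (Fin 2) ℝ => F ⟨xOf g, yOf g⟩ := hF.comp measurable_coordC
  rw [setLIntegral_haarSL2pm_of_subset hm (coordSet_subset A Θ), iwasawaMeasure, setLIntegral_map hm hFc measurable_iwasawa,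
    iwasawa_preimage_coordSet]
  have e : ∀ p : ℍ × AddCircle (2 * π), F ⟨xOf (iwasawa p), yOf (iwasawa p)⟩ = F (p.1 : ℂ) := by
    rintro ⟨z, θ⟩
    rw [xOf_iwasawa, yOf_iwasawa]
    exact congrArg F (Complex.ext rfl rfl)
  simp_rw [e]
  have hmeas : AEMeasurable (fun p : ℍ × AddCircle (2 * π) => F (p.1 : ℂ))
      ((volume.restrict (((↑) : ℍ → ℂ) ⁻¹' A)).prod (volume.restrict Θ)) :=
    Measurable.aemeasurable (by exact hF.comp (UpperHalfPlane.measurable_coe.comp measurable_fst))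
  rw [← Measure.prod_restrict, lintegral_prod _ hmeas]
  have e2 : ∀ z : ℍ, ∫⁻ _θ : AddCircle (2 * π), F (z : ℂ) ∂(volume.restrict Θ) = F (z : ℂ) * volume Θ := by
    intro z
    rw [lintegral_const, Measure.restrict_apply MeasurableSet.univ, Set.univ_inter]
  simp_rw [e2]
  rw [lintegral_mul_const _ (by exact hF.comp UpperHalfPlane.measurable_coe : Measurable fun z : ℍ => F (z : ℂ)),
    setLIntegral_coe_preimage hA hA' F hF]

end Measure

/-! ## Two regions of Gauss's fundamental domain: the strip above `Y₀` and the rectangle below -/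

/-- The strip `{|x| ≤ ½, y > Y₀}` (containing the cusp part of the fundamental domain). [folklore] -/
def stripAbove (Y₀ : ℝ) : Set ℂ := {w | |w.re| ≤ 1 / 2 ∧ Y₀ < w.im}

/-- The rectangle `{|x| ≤ ½, a ≤ y ≤ Y₀}`. [folklore] -/
def rectBetween (a Y₀ : ℝ) : Set ℂ := {w | |w.re| ≤ 1 / 2 ∧ a ≤ w.im ∧ w.im ≤ Y₀}

/-- The strip is measurable. [folklore] -/
theorem measurableSet_stripAbove (Y₀ : ℝ) : MeasurableSet (stripAbove Y₀) :=
  (measurableSet_le (continuous_abs.measurable.comp continuous_re.measurable) measurable_const).inter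
    (measurableSet_lt measurable_const continuous_im.measurable)

/-- The rectangle is measurable. [folklore] -/
theorem measurableSet_rectBetween (a Y₀ : ℝ) : MeasurableSet (rectBetween a Y₀) :=
  (measurableSet_le (continuous_abs.measurable.comp continuous_re.measurable) measurable_const).inter
    ((measurableSet_le measurable_const continuous_im.measurable).inter
      (measurableSet_le continuous_im.measurable measurable_const))

/-- The strip lies in `{Im > 0}` for `Y₀ ≥ 0`. [folklore] -/
theorem stripAbove_subset {Y₀ : ℝ} (hY : 0 ≤ Y₀) : stripAbove Y₀ ⊆ {w : ℂ | 0 < w.im} :=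
  fun _ hw => lt_of_le_of_lt hY hw.2

/-- The rectangle lies in `{Im > 0}` for `a > 0`. [folklore] -/
theorem rectBetween_subset {a Y₀ : ℝ} (ha : 0 < a) : rectBetween a Y₀ ⊆ {w : ℂ | 0 < w.im} :=
  fun _ hw => lt_of_lt_of_le ha hw.2.1

/-- `∫_{Y₀}^∞ y⁻² dy = 1/Y₀`. [folklore] -/
theorem integral_Ioi_inv_sq {Y₀ : ℝ} (hY : 0 < Y₀) : ∫ y in Set.Ioi Y₀, (1 / y ^ 2) = 1 / Y₀ := by
  have hderiv : ∀ y ∈ Set.Ici Y₀, HasDerivAt (fun y : ℝ => -y⁻¹) (1 / y ^ 2) y := by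
    intro y hy
    have hy0 : y ≠ 0 := (lt_of_lt_of_le hY hy).ne'
    have := (hasDerivAt_inv hy0).neg
    refine this.congr_deriv ?_; field_simp
  have hint : IntegrableOn (fun y : ℝ => 1 / y ^ 2) (Set.Ioi Y₀) := by
    have h := integrableOn_Ioi_rpow_of_lt (by norm_num : (-2 : ℝ) < -1) hY
    refine h.congr_fun (fun y hy => ?_) measurableSet_Ioi
    have hy0 : 0 < y := lt_trans hY hy
    show y ^ (-2 : ℝ) = 1 / y ^ 2
    rw [Real.rpow_neg hy0.le, Real.rpow_two, one_div]
  have htend : Tendsto (fun y : ℝ => -y⁻¹) atTop (𝓝 0) := by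
    have h := (tendsto_inv_atTop_zero : Tendsto (fun y : ℝ => y⁻¹) atTop (𝓝 0)).neg
    simpa using h
  rw [integral_Ioi_of_hasDerivAt_of_tendsto' hderiv hint htend, sub_neg_eq_add, zero_add, one_div]

/-- **The hyperbolic area of the strip**: `vol_ℍ{|x| ≤ ½, y > Y₀} = 1/Y₀`. [folklore] -/
theorem lintegral_stripAbove {Y₀ : ℝ} (hY : 0 < Y₀) :
    ∫⁻ w in stripAbove Y₀, ENNReal.ofReal (1 / w.im ^ 2) ∂volume = ENNReal.ofReal (1 / Y₀) := by
  have hmp := Complex.volume_preserving_equiv_real_prod.symm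
  rw [← hmp.setLIntegral_comp_preimage_emb Complex.measurableEquivRealProd.symm.measurableEmbedding]
  have hpre : Complex.measurableEquivRealProd.symm ⁻¹' stripAbove Y₀ = Set.Icc (-(1/2 : ℝ)) (1/2) ×ˢ Set.Ioi Y₀ := by
    ext p
    simp only [stripAbove, Set.mem_preimage, Set.mem_setOf_eq, Complex.measurableEquivRealProd_symm_apply, abs_le,
      Set.mem_prod, Set.mem_Icc, Set.mem_Ioi]
  rw [hpre]
  have hfg : (fun a : ℝ × ℝ => ENNReal.ofReal (1 / (Complex.measurableEquivRealProd.symm a).im ^ 2)) =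
      fun p => ENNReal.ofReal (1 / p.2 ^ 2) := by
    funext p; simp [Complex.measurableEquivRealProd_symm_apply]
  rw [hfg, Measure.volume_eq_prod, ← Measure.prod_restrict,
    lintegral_prod _ (by fun_prop : Measurable fun p : ℝ × ℝ => ENNReal.ofReal (1 / p.2 ^ 2)).aemeasurable]
  simp only
  rw [lintegral_const, Measure.restrict_apply MeasurableSet.univ, Set.univ_inter, Real.volume_Icc]
  have hI : ∫⁻ y in Set.Ioi Y₀, ENNReal.ofReal (1 / y ^ 2) = ENNReal.ofReal (1 / Y₀) := by
    rw [← integral_Ioi_inv_sq hY, ofReal_integral_eq_lintegral_ofReal]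
    · have h := integrableOn_Ioi_rpow_of_lt (by norm_num : (-2 : ℝ) < -1) hY
      refine h.congr_fun (fun y hy => ?_) measurableSet_Ioi
      have hy0 : 0 < y := lt_trans hY hy
      show y ^ (-2 : ℝ) = 1 / y ^ 2
      rw [Real.rpow_neg hy0.le, Real.rpow_two, one_div]
    · filter_upwards [ae_restrict_mem measurableSet_Ioi] with y hy
      positivity
  rw [hI, show (1 / 2 : ℝ) - -(1 / 2) = 1 by norm_num, ENNReal.ofReal_one, mul_one]

/-- **On the rectangle, `∫ y² · y⁻² = Y₀ − a`** (the integral of `y²` against the hyperbolic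
area). [folklore] -/
theorem lintegral_rectBetween {a Y₀ : ℝ} (ha : 0 < a) :
    ∫⁻ w in rectBetween a Y₀, ENNReal.ofReal (w.im ^ 2) * ENNReal.ofReal (1 / w.im ^ 2) ∂volume = ENNReal.ofReal (Y₀ - a) := by
  have e : ∀ w ∈ rectBetween a Y₀, ENNReal.ofReal (w.im ^ 2) * ENNReal.ofReal (1 / w.im ^ 2) = 1 := by
    intro w hw
    have hy : 0 < w.im := rectBetween_subset ha hw
    rw [← ENNReal.ofReal_mul (by positivity), mul_one_div_cancel (by positivity), ENNReal.ofReal_one]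
  rw [setLIntegral_congr_fun (measurableSet_rectBetween a Y₀) e, lintegral_one, Measure.restrict_apply MeasurableSet.univ,
    Set.univ_inter]
  have hmp := Complex.volume_preserving_equiv_real_prod.symm
  rw [← hmp.measure_preimage (measurableSet_rectBetween a Y₀).nullMeasurableSet]
  have hpre : Complex.measurableEquivRealProd.symm ⁻¹' rectBetween a Y₀ = Set.Icc (-(1/2 : ℝ)) (1/2) ×ˢ Set.Icc a Y₀ := by
    ext p
    simp only [rectBetween, Set.mem_preimage, Set.mem_setOf_eq, Complex.measurableEquivRealProd_symm_apply, abs_le,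
      Set.mem_prod, Set.mem_Icc]
  rw [hpre, Measure.volume_eq_prod, Measure.prod_prod, Real.volume_Icc, Real.volume_Icc,
    show (1 / 2 : ℝ) - -(1 / 2) = 1 by norm_num, ENNReal.ofReal_one, one_mul]

end Literature.MeasureTheory.Group

end
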